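import Mathlib
import Literature.Barriers.NavierStokesRegularity.DyadicInvariantRegion
import Literature.Analysis.ODE.MaximalTime
import Summits.NavierStokesRegularity.NavierStokesRegularity.Theorems.SubOnsagerCeilingDyadicMidRangeRegion
import HarnessLib

/-!
# Window region with TWO linear cuts for the rescaled Katz–Pavlović chain — the exit step
(helper file for crux stmt-NavierStokesRegularity-27057 `SubOnsagerCeiling.ForwardTailCeilingKP`, `--supports`)
`DyadicTwoCut.invariantRegionTwoCut_le_one_of_tail` = `DyadicMidRange.invariantRegionCut_le_one_of_tail` (sibling file
`SubOnsagerCeilingDyadicMidRangeRegion`) plus a SECOND linear three-window cut `e₂Yₙ + f₂Y_{n+1} + g₂Y_{n+2} ≤ d₂` (any signs);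
all inward-pointing inequalities are hypotheses (`hT`, `hB`, `hC`, `hC2`), each receiving both cuts on the neighbouring
windows; `hsmall2`/`hC20` = admissibility of the small box / of the window below the datum shell. Purpose: one-cut templates
certify the chain ceiling only down to `b ≈ 1.56` (LEAD census, crux 27057); the second cut is the next rung's freedom.
HONEST FRAMING: abstract ODE lemma towards a MODEL-lattice statement (rung under crux `ForwardTailCeilingKP`, route
SubOnsagerCeiling, TL-M2Break); nothing here bears on Navier–Stokes regularity. [cite: BarbatoMorandinRomito2011, §2 Lemma 2.1]
-/

noncomputable section

-- the sub-problem namespace `NavierStokesRegularity.NavierStokesRegularity` is the tree's layout (D-0017)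
set_option linter.dupNamespace false

namespace Summit.NavierStokesRegularity.NavierStokesRegularity.Theorems.DyadicTwoCut

open Set Filter Topology
open Literature.Barriers.NavierStokesRegularity.Dyadic
open Summit.NavierStokesRegularity.NavierStokesRegularity.Theorems.DyadicMidRange

/-- **Exit step of the two-cut region argument**: if every constraint holds at a time `T < s` along the
chain (all shells), then the finitely many constraints with index `≤ K` hold immediately to the right of `T`.
[cite: BarbatoMorandinRomito2011, §2 Lemma 2.1 (proof: the field points inward on every face)] -/
theorem twoCut_exit_step {Y : ℕ → ℝ → ℝ} {κ F : ℕ → ℝ}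
    {L p c s θ₀ m₁ m₂ a b₁ d e₂ f₂ g₂ d₂ T : ℝ} {K : ℕ}
    (hκ : ∀ n, 0 < κ n) (hκmono : ∀ n, κ n ≤ κ (n + 1)) (hκ4 : ∀ n, κ (n + 1) ≤ 4 * κ n)
    (hF : ∀ n, 0 < F n) (hFL : ∀ n, F (n + 1) = L * F n)
    (_hc : 0 ≤ c) (hpc : 1 ≤ p * c) (hp : 0 ≤ p)
    (hθ₀ : 1 / 10 ≤ θ₀) (hm : ∀ x, 0 ≤ x → x ≤ 1 → 0 ≤ m₁ + m₂ * x)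
    (hT : ∀ κ0 κ1 Fn x w z : ℝ, 0 < κ0 → κ0 ≤ κ1 → 0 < Fn → 0 ≤ x → x ≤ 1 →
      (θ₀ + m₁ * x + m₂ * x ^ 2) ≤ 1 → 0 ≤ w → w ≤ 1 → 0 ≤ z → z ≤ 1 →
      c * (((θ₀ + m₁ * x + m₂ * x ^ 2) - 1 / 10) / (9 / 10)) ^ 4 ≤ z →
      a * w - b₁ * x + (θ₀ + m₁ * x + m₂ * x ^ 2) ≤ d → a * x - b₁ * (θ₀ + m₁ * x + m₂ * x ^ 2) + z ≤ d →
      e₂ * w + f₂ * x + g₂ * (θ₀ + m₁ * x + m₂ * x ^ 2) ≤ d₂ → e₂ * x + f₂ * (θ₀ + m₁ * x + m₂ * x ^ 2) + g₂ * z ≤ d₂ →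
      (-κ1 * (θ₀ + m₁ * x + m₂ * x ^ 2) + L * Fn * (x ^ 2 - p * (θ₀ + m₁ * x + m₂ * x ^ 2) * z)) -
        (m₁ + 2 * m₂ * x) * (-κ0 * x + Fn * (w ^ 2 - p * x * (θ₀ + m₁ * x + m₂ * x ^ 2))) < 0)
    (hB : ∀ κ0 κ1 Fn x y z w : ℝ, 0 < κ0 → κ1 ≤ 4 * κ0 → 0 < Fn → 1 / 10 < x → x ≤ 1 →
      y = c * ((x - 1 / 10) / (9 / 10)) ^ 4 → 0 ≤ z → z ≤ 1 → z ≤ θ₀ + m₁ * y + m₂ * y ^ 2 →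
      a * x - b₁ * y + z ≤ d → 0 ≤ w → w ≤ 1 →
      a * w - b₁ * x + y ≤ d → e₂ * w + f₂ * x + g₂ * y ≤ d₂ → e₂ * x + f₂ * y + g₂ * z ≤ d₂ →
      4 * c * ((x - 1 / 10) / (9 / 10)) ^ 3 / (9 / 10) * (-κ0 * x + Fn * (w ^ 2 - p * x * y)) -
        (-κ1 * y + L * Fn * (x ^ 2 - p * y * z)) < 0)
    (hC : ∀ κ0 κ1 κ2 Fn w x y z v : ℝ, 0 < κ0 → κ0 ≤ κ1 → κ1 ≤ κ2 → κ1 ≤ 4 * κ0 →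
      κ2 ≤ 4 * κ1 → 0 < Fn → 0 ≤ w → w ≤ 1 → 0 ≤ x → x ≤ 1 → 0 ≤ y → y ≤ 1 → 0 ≤ z → z ≤ 1 →
      0 ≤ v → v ≤ 1 → a * x - b₁ * y + z = d →
      (w ≤ 1 / 10 ∨ c * ((w - 1 / 10) / (9 / 10)) ^ 4 ≤ x) → a * w - b₁ * x + y ≤ d →
      (x ≤ 1 / 10 ∨ c * ((x - 1 / 10) / (9 / 10)) ^ 4 ≤ y) → y ≤ θ₀ + m₁ * x + m₂ * x ^ 2 →
      (y ≤ 1 / 10 ∨ c * ((y - 1 / 10) / (9 / 10)) ^ 4 ≤ z) → z ≤ θ₀ + m₁ * y + m₂ * y ^ 2 →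
      (z ≤ 1 / 10 ∨ c * ((z - 1 / 10) / (9 / 10)) ^ 4 ≤ v) → v ≤ θ₀ + m₁ * z + m₂ * z ^ 2 →
      a * y - b₁ * z + v ≤ d →
      e₂ * w + f₂ * x + g₂ * y ≤ d₂ → e₂ * x + f₂ * y + g₂ * z ≤ d₂ → e₂ * y + f₂ * z + g₂ * v ≤ d₂ →
      a * (-κ0 * x + Fn * (w ^ 2 - p * x * y)) - b₁ * (-κ1 * y + L * Fn * (x ^ 2 - p * y * z)) +
        (-κ2 * z + L * L * Fn * (y ^ 2 - p * z * v)) < 0)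
    (hC2 : ∀ κ0 κ1 κ2 Fn w x y z v : ℝ, 0 < κ0 → κ0 ≤ κ1 → κ1 ≤ κ2 → κ1 ≤ 4 * κ0 →
      κ2 ≤ 4 * κ1 → 0 < Fn → 0 ≤ w → w ≤ 1 → 0 ≤ x → x ≤ 1 → 0 ≤ y → y ≤ 1 → 0 ≤ z → z ≤ 1 →
      0 ≤ v → v ≤ 1 → e₂ * x + f₂ * y + g₂ * z = d₂ →
      (w ≤ 1 / 10 ∨ c * ((w - 1 / 10) / (9 / 10)) ^ 4 ≤ x) →
      a * w - b₁ * x + y ≤ d → e₂ * w + f₂ * x + g₂ * y ≤ d₂ →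
      (x ≤ 1 / 10 ∨ c * ((x - 1 / 10) / (9 / 10)) ^ 4 ≤ y) → y ≤ θ₀ + m₁ * x + m₂ * x ^ 2 →
      a * x - b₁ * y + z ≤ d →
      (y ≤ 1 / 10 ∨ c * ((y - 1 / 10) / (9 / 10)) ^ 4 ≤ z) → z ≤ θ₀ + m₁ * y + m₂ * y ^ 2 →
      a * y - b₁ * z + v ≤ d → e₂ * y + f₂ * z + g₂ * v ≤ d₂ →
      (z ≤ 1 / 10 ∨ c * ((z - 1 / 10) / (9 / 10)) ^ 4 ≤ v) → v ≤ θ₀ + m₁ * z + m₂ * z ^ 2 →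
      e₂ * (-κ0 * x + Fn * (w ^ 2 - p * x * y)) + f₂ * (-κ1 * y + L * Fn * (x ^ 2 - p * y * z)) +
        g₂ * (-κ2 * z + L * L * Fn * (y ^ 2 - p * z * v)) < 0)
    (hpos : ∀ n, ∀ t ∈ Icc 0 s, 0 ≤ Y n t) (hT0 : 0 ≤ T) (hTb : T < s)
    (hcw : ∀ k, ContinuousWithinAt (Y k) (Ici T) T)
    (hd : ∀ k, 1 ≤ k → HasDerivWithinAt (Y k)
      (-κ k * Y k T + F k * (Y (k - 1) T ^ 2 - p * Y k T * Y (k + 1) T)) (Ici T) T)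
    (hle1 : ∀ k, Y k T ≤ 1) (hupp : ∀ k, 1 ≤ k → Y (k + 1) T ≤ θ₀ + m₁ * Y k T + m₂ * Y k T ^ 2)
    (hlow : ∀ k, 1 ≤ k →
      (if Y k T ≤ 1 / 10 then (0 : ℝ) else c * ((Y k T - 1 / 10) / (9 / 10)) ^ 4) ≤ Y (k + 1) T)
    (hlow0 : ∀ k, (Y k T ≤ 1 / 10 ∨ c * ((Y k T - 1 / 10) / (9 / 10)) ^ 4 ≤ Y (k + 1) T))
    (hcut' : ∀ k, a * Y k T - b₁ * Y (k + 1) T + Y (k + 2) T ≤ d)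
    (hcut2' : ∀ k, e₂ * Y k T + f₂ * Y (k + 1) T + g₂ * Y (k + 2) T ≤ d₂) :
    ∀ᶠ t in 𝓝[Ici T] T, (∀ n ∈ Finset.Icc 1 K, Y n t ≤ 1) ∧
      (∀ n ∈ Finset.Icc 1 K, Y (n + 1) t ≤ θ₀ + m₁ * Y n t + m₂ * Y n t ^ 2) ∧
      (∀ n ∈ Finset.Icc 1 K,
        (if Y n t ≤ 1 / 10 then (0 : ℝ) else c * ((Y n t - 1 / 10) / (9 / 10)) ^ 4) ≤ Y (n + 1) t) ∧
      (∀ n ∈ Finset.Icc 1 K, a * Y n t - b₁ * Y (n + 1) t + Y (n + 2) t ≤ d) ∧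
      (∀ n ∈ Finset.Icc 1 K, e₂ * Y n t + f₂ * Y (n + 1) t + g₂ * Y (n + 2) t ≤ d₂) := by
  set h : ℝ → ℝ := fun x => if x ≤ 1 / 10 then (0 : ℝ) else c * ((x - 1 / 10) / (9 / 10)) ^ 4 with hh
  set g : ℝ → ℝ := fun x => θ₀ + m₁ * x + m₂ * x ^ 2 with hg
  have hg_ge : ∀ x, 0 ≤ x → x ≤ 1 → 1 / 10 ≤ g x := by
    intro x hx0 hx1
    have := hm x hx0 hx1
    have e : g x = θ₀ + x * (m₁ + m₂ * x) := by simp only [hg]; ring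
    rw [e]; nlinarith
  have hg_cont : Continuous g := by
    have : g = fun x => θ₀ + m₁ * x + m₂ * x ^ 2 := rfl
    rw [this]; fun_prop
  have hg_deriv : ∀ x, HasDerivAt g (m₁ + 2 * m₂ * x) x := by
    intro x
    have h1 : HasDerivAt (fun x : ℝ => m₁ * x + m₂ * x ^ 2) (m₁ * 1 + m₂ * (↑2 * x ^ (2 - 1) * 1)) x :=
      ((hasDerivAt_id' x).const_mul m₁).add (((hasDerivAt_id' x).pow 2).const_mul m₂)
    have h2 := h1.const_add θ₀
    have e : (fun x : ℝ => θ₀ + (m₁ * x + m₂ * x ^ 2)) = g := by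
      funext y; simp only [hg]; ring
    rw [e] at h2
    refine h2.congr_deriv ?_
    push_cast; ring
  have hposT : ∀ k, 0 ≤ Y k T := fun k => hpos k T ⟨hT0, hTb.le⟩
  have hnhds : Icc 0 s ∈ 𝓝[Ici T] T := Icc_mem_nhdsGE_of_mem ⟨hT0, hTb⟩
  have huppg : ∀ k, 1 ≤ k → Y (k + 1) T ≤ g (Y k T) := fun k hk => hupp k hk
  have hlowh : ∀ k, 1 ≤ k → h (Y k T) ≤ Y (k + 1) T := fun k hk => hlow k hk
  have hFL2 : ∀ n, F (n + 2) = L * L * F n := by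
    intro n; rw [show n + 2 = (n + 1) + 1 from rfl, hFL, hFL]; ring
  have evR : ∀ n ∈ Finset.Icc 1 K, ∀ᶠ t in 𝓝[Ici T] T, Y n t ≤ 1 := by
    intro n hn
    obtain ⟨hn1, -⟩ := Finset.mem_Icc.1 hn
    rcases lt_or_eq_of_le (hle1 n) with hlt | heq
    · exact ((hcw n).eventually_lt_const hlt).mono fun t ht => ht.le
    · have hφ := (hd n hn1).sub_const 1
      have hz : c ≤ Y (n + 1) T := by
        rcases hlow0 n with h1 | h1
        · rw [heq] at h1; norm_num at h1
        · rw [heq] at h1; norm_num at h1; exact h1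
      have hneg : -κ n * Y n T + F n * (Y (n - 1) T ^ 2 - p * Y n T * Y (n + 1) T) < 0 := by
        have h1 : Y (n - 1) T ^ 2 ≤ 1 := by
          have := hle1 (n - 1); have := hposT (n - 1); nlinarith
        have h2 : 1 ≤ p * Y (n + 1) T := le_trans hpc (mul_le_mul_of_nonneg_left hz hp)
        have h3 : Y (n - 1) T ^ 2 - p * Y n T * Y (n + 1) T ≤ 0 := by rw [heq]; linarith
        have h4 : F n * (Y (n - 1) T ^ 2 - p * Y n T * Y (n + 1) T) ≤ 0 := mul_nonpos_of_nonneg_of_nonpos (hF n).le h3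
        have h5 : -κ n * Y n T < 0 := by rw [heq, mul_one]; linarith [hκ n]
        linarith
      exact (eventually_nonpos_of_hasDerivWithinAt_neg hφ hneg (by simp [heq])).mono
        fun t ht => by linarith
  have evT : ∀ n ∈ Finset.Icc 1 K, ∀ᶠ t in 𝓝[Ici T] T, Y (n + 1) t ≤ g (Y n t) := by
    intro n hn
    obtain ⟨hn1, -⟩ := Finset.mem_Icc.1 hn
    rcases lt_or_eq_of_le (huppg n hn1) with hlt | heq
    · have hc2 : ContinuousWithinAt (fun t => Y (n + 1) t - g (Y n t)) (Ici T) T :=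
        (hcw (n + 1)).sub (hg_cont.continuousAt.comp_continuousWithinAt (hcw n))
      have hlt' : Y (n + 1) T - g (Y n T) < 0 := by linarith
      exact (hc2.eventually_lt_const hlt').mono fun t (ht : Y (n + 1) t - g (Y n t) < 0) => by linarith
    · have hdn := hd n hn1
      have hdn1 := hd (n + 1) (by omega)
      simp only [Nat.add_sub_cancel] at hdn1
      have hchain := (hg_deriv (Y n T)).comp_hasDerivWithinAt T hdn
      have hφ := hdn1.sub hchain
      have hx0 : 0 ≤ Y n T := hposT n
      have hx1 : Y n T ≤ 1 := hle1 n
      have hy1 : g (Y n T) ≤ 1 := by rw [← heq]; exact hle1 (n + 1)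
      have hz : c * ((g (Y n T) - 1 / 10) / (9 / 10)) ^ 4 ≤ Y (n + 1 + 1) T := by
        rcases hlow0 (n + 1) with h1 | h1
        · rw [heq] at h1
          have hgx : g (Y n T) = 1 / 10 := le_antisymm h1 (hg_ge _ hx0 hx1)
          rw [hgx]; norm_num; exact hposT (n + 1 + 1)
        · rw [heq] at h1; exact h1
      have hc1a : a * Y (n - 1) T - b₁ * Y n T + g (Y n T) ≤ d := by
        have := hcut' (n - 1)
        rw [show n - 1 + 1 = n by omega, show n - 1 + 2 = n + 1 by omega, heq] at this; exact this
      have hc1b : a * Y n T - b₁ * g (Y n T) + Y (n + 1 + 1) T ≤ d := by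
        have := hcut' n; rw [heq] at this; exact this
      have hc2a : e₂ * Y (n - 1) T + f₂ * Y n T + g₂ * g (Y n T) ≤ d₂ := by
        have := hcut2' (n - 1)
        rw [show n - 1 + 1 = n by omega, show n - 1 + 2 = n + 1 by omega, heq] at this; exact this
      have hc2b : e₂ * Y n T + f₂ * g (Y n T) + g₂ * Y (n + 1 + 1) T ≤ d₂ := by
        have := hcut2' n; rw [heq] at this; exact this
      have hneg : (-κ (n + 1) * Y (n + 1) T + F (n + 1) * (Y n T ^ 2 - p * Y (n + 1) T * Y (n + 1 + 1) T)) -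
          (m₁ + 2 * m₂ * Y n T) * (-κ n * Y n T + F n * (Y (n - 1) T ^ 2 - p * Y n T * Y (n + 1) T)) < 0 := by
        rw [hFL n, heq]
        exact hT (κ n) (κ (n + 1)) (F n) (Y n T) (Y (n - 1) T) (Y (n + 1 + 1) T) (hκ n) (hκmono n)
          (hF n) hx0 hx1 hy1 (hposT (n - 1)) (hle1 (n - 1)) (hposT (n + 1 + 1)) (hle1 (n + 1 + 1)) hz
          hc1a hc1b hc2a hc2b
      have h0 : Y (n + 1) T - g (Y n T) ≤ 0 := by rw [heq]; simp
      exact (eventually_nonpos_of_hasDerivWithinAt_neg hφ (by simpa [Function.comp] using hneg) h0).mono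
        fun t (ht : Y (n + 1) t - g (Y n t) ≤ 0) => by linarith
  have evB : ∀ n ∈ Finset.Icc 1 K, ∀ᶠ t in 𝓝[Ici T] T, h (Y n t) ≤ Y (n + 1) t := by
    intro n hn
    obtain ⟨hn1, -⟩ := Finset.mem_Icc.1 hn
    by_cases hxδ : Y n T < 1 / 10
    · -- flat bottom piece: `h ≡ 0` and positivity
      have ev1 : ∀ᶠ t in 𝓝[Ici T] T, Y n t < 1 / 10 := (hcw n).eventually_lt_const hxδ
      have ev2 : ∀ᶠ t in 𝓝[Ici T] T, t ∈ Icc 0 s := by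
        filter_upwards [hnhds] with t ht using ht
      filter_upwards [ev1, ev2] with t ht hts
      simp only [hh]; rw [lowerCurve_of_le ht.le]
      exact hpos (n + 1) t hts
    · push Not at hxδ
      rcases lt_or_eq_of_le (hlowh n hn1) with hlt | heq
      · have hc2 : ContinuousWithinAt (fun t => h (Y n t) - Y (n + 1) t) (Ici T) T :=
          (((continuous_lowerCurve c).continuousAt).comp_continuousWithinAt (hcw n)).sub (hcw (n + 1))
        have hlt' : h (Y n T) - Y (n + 1) T < 0 := by linarith
        exact (hc2.eventually_lt_const hlt').mono fun t ht => by linarith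
      · -- active constraint
        have hdn := hd n hn1
        have hdn1 := hd (n + 1) (by omega)
        simp only [Nat.add_sub_cancel] at hdn1
        have hchain := (hasDerivAt_lowerCurve c (Y n T)).comp_hasDerivWithinAt T hdn
        have hφ := hchain.sub hdn1
        have h0 : h (Y n T) - Y (n + 1) T ≤ 0 := by rw [heq]; simp
        rcases eq_or_lt_of_le hxδ with hxeq | hxgt
        · -- the corner `x = 1/10`: `h = h' = 0`, `Y_{n+1} = 0`
          have hy0 : Y (n + 1) T = 0 := by
            rw [← heq]; simp only [hh]; exact lowerCurve_of_le hxeq.symm.le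
          have hneg : (if Y n T ≤ 1 / 10 then (0 : ℝ)
                else 4 * c * ((Y n T - 1 / 10) / (9 / 10)) ^ 3 / (9 / 10)) *
                (-κ n * Y n T + F n * (Y (n - 1) T ^ 2 - p * Y n T * Y (n + 1) T)) -
              (-κ (n + 1) * Y (n + 1) T + F (n + 1) * (Y n T ^ 2 - p * Y (n + 1) T * Y (n + 1 + 1) T)) < 0 := by
            rw [if_pos hxeq.symm.le, hy0, ← hxeq]
            have := hF (n + 1)
            nlinarith
          exact (eventually_nonpos_of_hasDerivWithinAt_neg hφ hneg h0).mono fun t ht => by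
            simpa [Function.comp, hh] using ht
        · -- `x > 1/10`: the curved piece, hypothesis `hB`
          have hy : Y (n + 1) T = c * ((Y n T - 1 / 10) / (9 / 10)) ^ 4 := by
            rw [← heq]; simp only [hh]; rw [if_neg (not_le.2 hxgt)]
          have hneg : (if Y n T ≤ 1 / 10 then (0 : ℝ)
                else 4 * c * ((Y n T - 1 / 10) / (9 / 10)) ^ 3 / (9 / 10)) *
                (-κ n * Y n T + F n * (Y (n - 1) T ^ 2 - p * Y n T * Y (n + 1) T)) -
              (-κ (n + 1) * Y (n + 1) T + F (n + 1) * (Y n T ^ 2 - p * Y (n + 1) T * Y (n + 1 + 1) T)) < 0 := by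
            rw [if_neg (not_le.2 hxgt), hFL n]
            exact hB (κ n) (κ (n + 1)) (F n) (Y n T) (Y (n + 1) T) (Y (n + 1 + 1) T) (Y (n - 1) T)
              (hκ n) (hκ4 n) (hF n) hxgt (hle1 n) hy (hposT (n + 1 + 1)) (hle1 (n + 1 + 1))
              (huppg (n + 1) (by omega)) (hcut' n) (hposT (n - 1)) (hle1 (n - 1))
              (by have := hcut' (n - 1); rwa [show n - 1 + 1 = n by omega, show n - 1 + 2 = n + 1 by omega] at this)
              (by have := hcut2' (n - 1); rwa [show n - 1 + 1 = n by omega, show n - 1 + 2 = n + 1 by omega] at this)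
              (hcut2' n)
          exact (eventually_nonpos_of_hasDerivWithinAt_neg hφ hneg h0).mono fun t ht => by
            simpa [Function.comp, hh] using ht
  have evC : ∀ n ∈ Finset.Icc 1 K, ∀ᶠ t in 𝓝[Ici T] T,
      a * Y n t - b₁ * Y (n + 1) t + Y (n + 2) t ≤ d := by
    intro n hn
    obtain ⟨hn1, -⟩ := Finset.mem_Icc.1 hn
    rcases lt_or_eq_of_le (hcut' n) with hlt | heq
    · have hc2 : ContinuousWithinAt (fun t => a * Y n t - b₁ * Y (n + 1) t + Y (n + 2) t - d)
          (Ici T) T := (((continuousWithinAt_const.mul (hcw n)).sub (continuousWithinAt_const.mul (hcw (n + 1)))).add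
          (hcw (n + 2))).sub continuousWithinAt_const
      have hlt' : a * Y n T - b₁ * Y (n + 1) T + Y (n + 2) T - d < 0 := by linarith
      exact (hc2.eventually_lt_const hlt').mono
        fun t (ht : a * Y n t - b₁ * Y (n + 1) t + Y (n + 2) t - d < 0) => by linarith
    · have hdn := hd n hn1
      have hdn1 := hd (n + 1) (by omega)
      have hdn2 := hd (n + 2) (by omega)
      simp only [Nat.add_sub_cancel] at hdn1
      simp only [show n + 2 - 1 = n + 1 by omega] at hdn2
      have hφ := (((hdn.const_mul a).sub (hdn1.const_mul b₁)).add hdn2).sub_const d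
      have hneg : a * (-κ n * Y n T + F n * (Y (n - 1) T ^ 2 - p * Y n T * Y (n + 1) T)) -
            b₁ * (-κ (n + 1) * Y (n + 1) T + F (n + 1) * (Y n T ^ 2 - p * Y (n + 1) T * Y (n + 1 + 1) T)) +
          (-κ (n + 2) * Y (n + 2) T + F (n + 2) * (Y (n + 1) T ^ 2 - p * Y (n + 2) T * Y (n + 2 + 1) T)) < 0 := by
        rw [hFL n, hFL2 n, show n + 1 + 1 = n + 2 by omega]
        exact hC (κ n) (κ (n + 1)) (κ (n + 2)) (F n) (Y (n - 1) T) (Y n T) (Y (n + 1) T)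
          (Y (n + 2) T) (Y (n + 2 + 1) T) (hκ n) (hκmono n) (hκmono (n + 1)) (hκ4 n) (hκ4 (n + 1))
          (hF n) (hposT (n - 1)) (hle1 (n - 1)) (hposT n) (hle1 n) (hposT (n + 1)) (hle1 (n + 1))
          (hposT (n + 2)) (hle1 (n + 2)) (hposT (n + 2 + 1)) (hle1 (n + 2 + 1)) heq
          (by have := hlow0 (n - 1); rwa [show n - 1 + 1 = n by omega] at this)
          (by have := hcut' (n - 1); rwa [show n - 1 + 1 = n by omega, show n - 1 + 2 = n + 1 by omega] at this)
          (hlow0 n) (huppg n hn1)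
          (hlow0 (n + 1)) (huppg (n + 1) (by omega))
          (by have := hlow0 (n + 2); rwa [show n + 2 + 1 = n + 2 + 1 from rfl] at this)
          (huppg (n + 2) (by omega))
          (by have := hcut' (n + 1); rwa [show n + 1 + 1 = n + 2 by omega, show n + 1 + 2 = n + 2 + 1 by omega] at this)
          (by have := hcut2' (n - 1); rwa [show n - 1 + 1 = n by omega, show n - 1 + 2 = n + 1 by omega] at this)
          (hcut2' n)
          (by have := hcut2' (n + 1); rwa [show n + 1 + 1 = n + 2 by omega, show n + 1 + 2 = n + 2 + 1 by omega] at this)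
      have h0 : a * Y n T - b₁ * Y (n + 1) T + Y (n + 2) T - d ≤ 0 := by rw [heq]; simp
      exact (eventually_nonpos_of_hasDerivWithinAt_neg hφ (by simpa using hneg) h0).mono
        fun t (ht : a * Y n t - b₁ * Y (n + 1) t + Y (n + 2) t - d ≤ 0) => by linarith
  have evC2 : ∀ n ∈ Finset.Icc 1 K, ∀ᶠ t in 𝓝[Ici T] T,
      e₂ * Y n t + f₂ * Y (n + 1) t + g₂ * Y (n + 2) t ≤ d₂ := by
    intro n hn
    obtain ⟨hn1, -⟩ := Finset.mem_Icc.1 hn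
    rcases lt_or_eq_of_le (hcut2' n) with hlt | heq
    · have hc2 : ContinuousWithinAt (fun t => e₂ * Y n t + f₂ * Y (n + 1) t + g₂ * Y (n + 2) t - d₂)
          (Ici T) T := (((continuousWithinAt_const.mul (hcw n)).add (continuousWithinAt_const.mul (hcw (n + 1)))).add
          (continuousWithinAt_const.mul (hcw (n + 2)))).sub continuousWithinAt_const
      have hlt' : e₂ * Y n T + f₂ * Y (n + 1) T + g₂ * Y (n + 2) T - d₂ < 0 := by linarith
      exact (hc2.eventually_lt_const hlt').mono
        fun t (ht : e₂ * Y n t + f₂ * Y (n + 1) t + g₂ * Y (n + 2) t - d₂ < 0) => by linarith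
    · have hdn := hd n hn1
      have hdn1 := hd (n + 1) (by omega)
      have hdn2 := hd (n + 2) (by omega)
      simp only [Nat.add_sub_cancel] at hdn1
      simp only [show n + 2 - 1 = n + 1 by omega] at hdn2
      have hφ := (((hdn.const_mul e₂).add (hdn1.const_mul f₂)).add (hdn2.const_mul g₂)).sub_const d₂
      have hneg : e₂ * (-κ n * Y n T + F n * (Y (n - 1) T ^ 2 - p * Y n T * Y (n + 1) T)) +
            f₂ * (-κ (n + 1) * Y (n + 1) T + F (n + 1) * (Y n T ^ 2 - p * Y (n + 1) T * Y (n + 1 + 1) T)) +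
          g₂ * (-κ (n + 2) * Y (n + 2) T +
            F (n + 2) * (Y (n + 1) T ^ 2 - p * Y (n + 2) T * Y (n + 2 + 1) T)) < 0 := by
        rw [hFL n, hFL2 n, show n + 1 + 1 = n + 2 by omega]
        exact hC2 (κ n) (κ (n + 1)) (κ (n + 2)) (F n) (Y (n - 1) T) (Y n T) (Y (n + 1) T)
          (Y (n + 2) T) (Y (n + 2 + 1) T) (hκ n) (hκmono n) (hκmono (n + 1)) (hκ4 n) (hκ4 (n + 1))
          (hF n) (hposT (n - 1)) (hle1 (n - 1)) (hposT n) (hle1 n) (hposT (n + 1)) (hle1 (n + 1))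
          (hposT (n + 2)) (hle1 (n + 2)) (hposT (n + 2 + 1)) (hle1 (n + 2 + 1)) heq
          (by have := hlow0 (n - 1); rwa [show n - 1 + 1 = n by omega] at this)
          (by have := hcut' (n - 1); rwa [show n - 1 + 1 = n by omega, show n - 1 + 2 = n + 1 by omega] at this)
          (by have := hcut2' (n - 1); rwa [show n - 1 + 1 = n by omega, show n - 1 + 2 = n + 1 by omega] at this)
          (hlow0 n) (huppg n hn1) (hcut' n)
          (hlow0 (n + 1)) (huppg (n + 1) (by omega))
          (by have := hcut' (n + 1); rwa [show n + 1 + 1 = n + 2 by omega, show n + 1 + 2 = n + 2 + 1 by omega] at this)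
          (by have := hcut2' (n + 1); rwa [show n + 1 + 1 = n + 2 by omega, show n + 1 + 2 = n + 2 + 1 by omega] at this)
          (by have := hlow0 (n + 2); rwa [show n + 2 + 1 = n + 2 + 1 from rfl] at this)
          (huppg (n + 2) (by omega))
      have h0 : e₂ * Y n T + f₂ * Y (n + 1) T + g₂ * Y (n + 2) T - d₂ ≤ 0 := by rw [heq]; simp
      exact (eventually_nonpos_of_hasDerivWithinAt_neg hφ (by simpa using hneg) h0).mono
        fun t (ht : e₂ * Y n t + f₂ * Y (n + 1) t + g₂ * Y (n + 2) t - d₂ ≤ 0) => by linarith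
  have e1 := (Filter.eventually_all_finset _).2 evR
  have e2 := (Filter.eventually_all_finset _).2 evT
  have e3 := (Filter.eventually_all_finset _).2 evB
  have e4 := (Filter.eventually_all_finset _).2 evC
  have e5 := (Filter.eventually_all_finset _).2 evC2
  filter_upwards [e1, e2, e3, e4, e5] with t h1 h2 h3 h4 h5
  exact ⟨h1, h2, h3, h4, h5⟩

end Summit.NavierStokesRegularity.NavierStokesRegularity.Theorems.DyadicTwoCut

end
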